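import Summits.Ventures.PercRepro.ProfilePointedCircuitClassesStarSharpDefectC

/-!
# PercRepro — THE PARALLEL REGIMES `b ∥ e`, `b ∥ f` OF CASE D0 WITH AT MOST THREE DEFECTS
(p5, gen 55; `proofs/P5-GM1.md` §82 ADD 4)

If `b` is parallel to a point `y ∈ E₇` in `N ／ b′` (`ρ{y, b, b′} = 2`, `ρ{b, b′} = 2`), a set `S ⊆ E₇` is ON iff
`y ∈ cl(S)` (`on_iff_of_parallel`).  For `y = f` every ON demand `π + e + b` has `f ∈ cl(π + e)`, the swap `π + f + b`
is ON whenever it is bi-independent, and the bi-basis `π + e + f` is never one, so the demands without a swap are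
exactly the defects of `R` and the generic count applies (`inCount_thru_le_of_par_f_of_le_three_bad`).  For `y = e`
every demand is ON; besides the swaps, the demands whose complement is OFF with `ρ(π + e + f) = 4` inject into the
bi-bases with an ON pair (`d0_injR2''`), and the remaining demands are again defects of `R`
(`inCount_thru_le_of_par_e_of_le_three_bad`).  Both carry the instance condition «at most three defects» (true on
every configuration of the catalogue: `|bad| ≤ 3` on all 1,180 + 1,248, §82 ADD 1 (c)).
-/

open scoped Matroid

namespace PercRepro.Cogirth

open Finset ThmH Skew Shadow Profile

open Classical

variable {α : Type} [DecidableEq α] {N : Matroid α} [N.Finite]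

section StarSharpParA

variable {b b' : α}

/-- `insert b (insert b' S) = insert b' (insert b S)`. -/
theorem insert_bb'_comm (b b' : α) (S : Finset α) : insert b (insert b' S) = insert b' (insert b S) :=
  insert_comm _ _ _

/-- **THE PRINCIPAL CUT**: if `ρ{y, b, b′} = 2` and `ρ{b, b′} = 2` for `y ∈ E₇` (not a loop), then `S ⊆ E₇` is ON
iff `y ∈ cl(S)`. -/
theorem on_iff_of_parallel (h : SeriesPair N b b') {y : α} (hy : y ∈ ((gr N).erase b).erase b') (hy1 : rk N {y} = 1)
    (hpar : rk N {y, b, b'} = 2) (hbb2 : rk N {b, b'} = 2) {S : Finset α} (hS : S ⊆ ((gr N).erase b).erase b') :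
    rk N (insert b (insert b' S)) = rk N S + 1 ↔ rk N (insert y S) = rk N S := by
  have hyb : rk N ({y, b} : Finset α) = 2 := by
    have := rk_insert_left_eq_add_one_of_seriesPair h (Y := ({y} : Finset α)) (singleton_subset_iff.2 hy)
    rw [pair_comm', this, hy1]
  have hb'yb : rk N (insert b' ({y, b} : Finset α)) = rk N ({y, b} : Finset α) := by
    rw [← triple_eq_insert_last, hpar, hyb]
  have hybb' : rk N (insert y ({b, b'} : Finset α)) = rk N ({b, b'} : Finset α) := by rw [hpar, hbb2]
  have h1 := rk_insert_left_eq_add_one_of_seriesPair h hS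
  have hbnd := rk_insert_bb'_bounds h hS
  constructor
  · intro hon
    by_contra hne
    have hy' : rk N (insert y S) = rk N S + 1 := by
      have h2 := rk_insert_le_add_one (N := N) ((erase_subset _ _).trans (erase_subset _ _) hy) (X := S)
        (hS.trans ((erase_subset _ _).trans (erase_subset _ _)))
      have h3 : rk N S ≤ rk N (insert y S) := rk_mono' (subset_insert _ _)
      omega
    have h4 : rk N (insert b' (insert b S)) = rk N (insert b S) := by rw [← insert_bb'_comm, hon, h1]
    have hsub1 : ({b, b'} : Finset α) ⊆ insert b' (insert b S) := by
      intro a ha; simp only [mem_insert, mem_singleton] at ha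
      rcases ha with rfl | rfl
      · exact mem_insert_of_mem (mem_insert_self _ _)
      · exact mem_insert_self _ _
    have h5 := rk_insert_eq_of_rk_insert_eq_subset' (N := N) (S := ({b, b'} : Finset α)) (S' := insert b' (insert b S))
      (w := y) hsub1 hybb'
    have h6 := rk_insert_left_eq_add_one_of_seriesPair h (Y := insert y S) (insert_subset hy hS)
    have h7 : rk N (insert b (insert y S)) ≤ rk N (insert y (insert b' (insert b S))) :=
      rk_mono' (by intro a ha; simp only [mem_insert] at ha ⊢; tauto)
    rw [h6, hy', h5, h4, h1] at h7
    omega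
  · intro hcl
    have h2 := rk_insert_eq_of_rk_insert_eq_subset' (N := N) (S := S) (S' := insert b S) (w := y) (subset_insert _ _) hcl
    have hsub2 : ({y, b} : Finset α) ⊆ insert y (insert b S) := by
      intro a ha; simp only [mem_insert, mem_singleton] at ha
      rcases ha with rfl | rfl
      · exact mem_insert_self _ _
      · exact mem_insert_of_mem (mem_insert_self _ _)
    have h3 := rk_insert_eq_of_rk_insert_eq_subset' (N := N) (S := ({y, b} : Finset α)) (S' := insert y (insert b S))
      (w := b') hsub2 hb'yb
    have h4 : rk N (insert b (insert b' S)) ≤ rk N (insert b' (insert y (insert b S))) :=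
      rk_mono' (by intro a ha; simp only [mem_insert] at ha ⊢; tauto)
    rw [h3, h2, h1] at h4
    omega

/-- **THE REGIME `b ∥ f` WITH AT MOST THREE DEFECTS**: `ρ{f, b, b′} = 2`, `ρ{b, b′} = 2`, at most three demands
without a swap; then the `b′`-avoiding inequality holds. -/
theorem inCount_thru_le_of_par_f_of_le_three_bad (hn : (gr N).card = 9) (h : SeriesPair N b b')
    {e f : α} (he : e ∈ gr N) (hf : f ∈ gr N) (hef : e ≠ f) (heb : e ≠ b) (heb' : e ≠ b') (hfb : f ≠ b) (hfb' : f ≠ b')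
    (he1 : ∀ y ∈ ((((gr N).erase b).erase b').erase f).erase e, rk N {e, y} = 2)
    (hf1 : ∀ y ∈ ((((gr N).erase b).erase b').erase f).erase e, rk N {f, y} = 2)
    (hfc : ∀ y ∈ ((((gr N).erase b).erase b').erase f).erase e, rk N (((((gr N).erase b).erase b').erase f).erase y) = 4)
    (hX : rk N (((((gr N).erase b).erase b').erase f).erase e) = 4) (hef2 : rk N {e, f} = 2)
    (hpf : rk N {f, b, b'} = 2) (hbb2 : rk N {b, b'} = 2)
    (hthree : ∀ W₁ ∈ d0DON N b' e f, ∀ W₂ ∈ d0DON N b' e f, ∀ W₃ ∈ d0DON N b' e f, ∀ W₄ ∈ d0DON N b' e f,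
      ¬ d0c0 N b b' e f W₁ → ¬ d0c0 N b b' e f W₂ → ¬ d0c0 N b b' e f W₃ → ¬ d0c0 N b b' e f W₄ →
      W₁ = W₂ ∨ W₁ = W₃ ∨ W₁ = W₄ ∨ W₂ = W₃ ∨ W₂ = W₄ ∨ W₃ = W₄) :
    inCount N 4 e + thruCount N 4 {b', f} + thruCount N 4 {b', e, f} ≤
      inCount N 4 f + thruCount N 4 {e, f} + thruCount N 4 {b', e} := by
  have hfE : f ∈ ((gr N).erase b).erase b' := mem_erase.2 ⟨hfb', mem_erase.2 ⟨hfb, hf⟩⟩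
  have heE : e ∈ ((gr N).erase b).erase b' := mem_erase.2 ⟨heb', mem_erase.2 ⟨heb, he⟩⟩
  have hXE : ((((gr N).erase b).erase b').erase f).erase e ⊆ ((gr N).erase b).erase b' :=
    (erase_subset _ _).trans (erase_subset _ _)
  have hf1' : rk N ({f} : Finset α) = 1 := by
    have h1 := rk_insert_le_add_one (N := N) he (X := ({f} : Finset α)) (singleton_subset_iff.2 hf)
    have h2 := rk_le_card' (M := N) ({f} : Finset α)
    rw [card_singleton] at h2
    rw [hef2] at h1
    omega
  -- a set containing `f` is ON
  have hon : ∀ S : Finset α, S ⊆ ((gr N).erase b).erase b' → f ∈ S → rk N (insert b (insert b' S)) = rk N S + 1 := by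
    intro S hS hfS
    rw [on_iff_of_parallel h hfE hf1' hpf hbb2 hS, insert_eq_of_mem hfS]
  apply inCount_thru_le_of_loop_of_bad_bound hn h he hf hef heb heb' hfb hfb'
  have hdata := d0_demand_data h hn hf hef heb hfb hfb' (e := e)
  apply card_bad_le_targets_of_card_le_three_P hn h he hf hef heb heb' hfb hfb' he1 hf1 hfc hX hef2
    (P := fun W => ¬ d0c0 N b b' e f W)
  · intro W hW
    have hW' := mem_filter.1 hW
    have hWd := hW'.1
    simp only [d0DON, mem_filter] at hWd
    obtain ⟨-, hπX, -, -, -, -, -, -⟩ := hdata W hWd.1 hWd.2.1 hWd.2.2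
    rintro ⟨h1, h2⟩
    apply hW'.2
    exact ⟨h1, h2, by rw [hon _ (insert_subset hfE (hπX.trans hXE)) (mem_insert_self _ _), h1]⟩
  · intro x hx hefx hx4
    have hS : ({e, f, x} : Finset α) ⊆ ((gr N).erase b).erase b' := by
      intro w hw; simp only [mem_insert, mem_singleton] at hw
      rcases hw with rfl | rfl | rfl
      · exact heE
      · exact hfE
      · exact hXE hx
    have hS3' : ({e, f, x} : Finset α).card = 3 := by
      have hxe : x ≠ e := (mem_erase.1 hx).1
      have hxf : x ≠ f := (mem_erase.1 (mem_erase.1 hx).2).1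
      rw [card_insert_of_notMem, card_pair hxf.symm]
      simp only [mem_insert, mem_singleton, not_or]; exact ⟨hef, hxe.symm⟩
    have hbb' : b ≠ b' := h.2.2.1
    simp only [mem_filter]
    refine ⟨?_, ⟨mem_insert_of_mem (mem_insert_of_mem (mem_insert_self _ _)), ?_⟩,
      mem_insert_of_mem (mem_insert_self _ _), mem_insert_self _ _, ?_⟩
    · rw [insert_b_mem_biIndepSets_iff h hn hS hS3', E7_sdiff_efx_eq]
      exact ⟨hefx, hx4⟩
    · intro h'
      simp only [mem_insert, mem_singleton] at h'
      rcases h' with h2 | h2 | h2 | h2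
      · exact hbb' h2.symm
      · exact heb' h2.symm
      · exact hfb' h2.symm
      · exact (mem_erase.1 (hXE hx)).1 h2.symm
    · rw [off_image_efx_iff h hn he hf hef heb heb' hfb hfb' hx]
      rintro ⟨-, h5⟩
      have := hon ({e, f, x} : Finset α) hS (mem_insert_of_mem (mem_insert_self _ _))
      rw [hefx] at this
      omega
  · apply card_le_three_of_no_four
    intro x hx y hy z hz w hw
    simp only [mem_filter] at hx hy hz hw
    exact hthree x hx.1 y hy.1 z hz.1 w hw.1 hx.2 hy.2 hz.2 hw.2

end StarSharpParA

end PercRepro.Cogirth
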